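import Summits.NavierStokesRegularity.TurbBounds.Certs.N0.EvalBlocks
import Summits.NavierStokesRegularity.TurbBounds.IntervalLemma
import Summits.NavierStokesRegularity.TurbBounds.IntervalLemmaR
import HarnessLib

/-!
# Evaluator for row N0 — the projected mode rule `M(ε; u, v)` of rbsdp SPEC §3, the 17 block identities, and the
# kernel-checked FINITE CERTIFICATE of N0 on the wavenumber CONTINUUM `0 < K = k² ≤ K_c = 39`
(cell `pub-turb` / `turb-bounds`, task T12 / LEAN-MAP §1–§2 'evaluator lemma'; producer of THIS FILE pub-turb-sos = planner-pub-turb-sos-g6-0;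
row and source container by pub-turb-cert: `HOME/pub-turb-cert/certs/N0-ra1000-allk/rbcert.json`, rbcert/0, sha256 `a5d8ddb22865e232…`; CERTIFIED.md row RB-N0).

HONEST FRAMING: rigorous bounds for the stated PDE and boundary conditions; no claim about physical turbulence beyond the bound.
This file contains NO fluid mechanics and claims nothing about `Nu` by itself. WHAT IT KERNEL-CHECKS (nothing trusted, no
`native_decide`): for Rayleigh–Bénard convection data `Ra = 1000`, CONDUCTION background (`φ̂ ≡ 0`, `P = 0`) with balance parameter
`s = 3` (`T = s = 3`, coupling coefficient `ĝ₀ = −s`), Legendre truncation `N = 8` (`LW = 11` coefficients of `W_xx`, `LT = 10` of `Θ_x`,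
stacked `ψ = (c; d)` and PROJECTED to the no-slip class `c₀ = c₁ = d₀ = 0`, dim 18):
1. `Mel ε u v` — the mode matrix rule of rbsdp SPEC 3.3–3.6 (`RBMode.block_at`), `M = a0·PW(u,v) + s·PT(v) + ĝ₀·CE₀ + T·CT(ε)`, `a0 = (s−1)/Ra`,
   written out as an AFFINE function of the wavenumber data `(u, v) = (KINV2, K2) = (1/k², k²)`-bounds and of the Young weight `ε`:
   `PW(u,v) = PW0 + u·PWu + v·PWv`, `PT(v) = PT0 + v·PTv`, `CT(ε) = −ε·TW − ε⁻¹·TT`, from eight rational 18×18 PIECES (§2). The pieces are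
   DATA transcribed from rbsdp SPEC 3.3–3.6 (ladders `D1, D0, DT`, Legendre norms `2/(2n+1)`, triple products `Λ(n,m′,0)`, tail Grams
   `GW0+HW`, `GT0+HT`, projection `keep`) by the producer script `t12_evaluator.py` from generator A's own objects (rbsdp 0.2.x / kint 0.1.x,
   unmodified); that these literal matrices ARE those Legendre–Galerkin objects is NOT proved here (generator B re-derives them independently:
   gen_b A/B EQUAL 17/17 for this row, tribunal/t2-verify.md §3) — see 'NOT CHECKED' below.
2. `eval_k` (k = 1…17): the certified block of `Certs.N0.B0kk` IS the rule evaluated at the block's data,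
   `B0kk.A = den_k • Mel ε_k u_k v_k` — 17 × 324 rational identities by `decide +kernel` (the 'evaluator lemma' of LEAN-MAP §1).
3. `Mel_pencil`: `Mel ε u v = M0 ε + u • Acoef + v • Bcoef` (module algebra, `ring`), and Gram certificates (`PSD.IsGramCert`,
   `decide +kernel`, tree soundness theorem `IsGramCert.posSemidef`) for BOTH pencil coefficients: `Acoef = a0·16·diag(2/(2n+1))|_kept ⊕ 0`
   and `Bcoef = a0·D0ᵀdiag(2/(2n+1))D0 ⊕ s·DTᵀdiag(2/(2n+1))DT` (kept columns) are positive semidefinite (the hypothesis of the interval lemma R-I).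
4. `interval_1 … interval_9`: the two blocks of each 'tangent' pair of THIS row carry DIFFERENT Young weights `ε` (rbsdp's rule at each
   block's own `u`), so the plain interval lemma R-I does not apply literally; **lemma R-I′** (CERT-RB §R, referee-authored addendum,
   t-lemmas pass 3) is PROVED in Lean in `TurbBounds/IntervalLemmaR.lean` (staged with this file; `pencil_on_interval_tangent_mixed`: convexity of the PSD cone along the tangent
   data path, `tangent_le_inv` from IntervalLemma.lean (p243191), `A ⪰ 0`, and the Young-weight mixing inequality `1/ε ≤ (1−t)/ε₁ + t/ε₂` paid for
   by `TT ⪰ 0` (`TT_gram`)), together with the 'bottom' companion of R-I (`posSemidef_pencil_on_bottom`). Result per cover interval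
   (0, 1/2] · [1/2, 1] · [1, 2] · [2, 4] · [4, 8] · [8, 11585/1024] · [11585/1024, 16] · [16, 32] · [32, 39]: for EVERY real `K` in it there is a REAL Young
   weight `ε > 0` (a convex combination of the pair's two rational weights) with `MelR ε (1/K) K ⪰ 0` AND both scalar tail conditions.
5. `certificate`: for every real `K` with `0 < K ≤ 39` there is a real `ε > 0` with `MelR ε (1/K) K ⪰ 0` AND the two scalar tail
   conditions `16·(1/K)·a0 − T·ε·λ_W ≥ 0`, `4s − T·λ_T/ε ≥ 0` of rbsdp SPEC 3.7 (λ_W = 16/229425, λ_T = 4/437; `lamW_rule`/`lamT_rule` re-derive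
   them from SPEC 3.4/3.6's closed form `λ(J, J+1) = 4/((2J+1)(2J+5))` at `LW = 11`, `LT = 10`); and `cutoff`: `T² ≤ a0·s·K_c²` at `K_c = 39` (SPEC 3.8 D1).
   (FWGP17 Lemma 5 / SPEC 3.6: EVERY `ε > 0` is an admissible Young weight, so a real, K-dependent `ε` is as good as a rational one.)

HOW THIS IS USED (refereed prose, NOT formalised — HOME/CERT-RB.md §R (R-T, R-I, D1), rbsdp SPEC §3, tribunal/t-lemmas.md passes 1–3): by the
tail lemma R-T (SPEC 3.4–3.7, any Young weight `ε > 0`), `MelR ε (1/K) K ⪰ 0` with both tail scalars `≥ 0` implies the single-wavenumber spectral constraint `Q_k ≥ 0` of the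
Doering–Constantin background method in Ding–Kerswell's affine form [cite: DingKerswell2019, (13)–(16)] (FORMULATION-SPEC (A1)⇒(A2), FWGP17 Thm 2)
at `k² = K` for the conduction background with balance parameter `s` at `Ra = 1000`, on the no-slip isothermal class; by D1 (SPEC 3.8) the same
holds for every `k² ≥ K_c`; hence the constraint holds for ALL real `k > 0`, i.e. for EVERY horizontal period (d = 2) / lattice (d = 3) and
every Pr, whence `Nu ≤ 1 + Σ_p φ̂_p²/((2p+1)s) = 1` (row RB-N0 of HOME/CERTIFIED.md: energy-stability-type statement `Nu = 1` at `Ra = 1000`).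

NOT CHECKED HERE (LEAN-MAP items): (a) that the eight piece matrices are rbsdp's projected Legendre–Galerkin objects for (N, P) = (8, 0) — DATA,
re-derivable from SPEC 3.3–3.6 by anyone and re-derived by generator B; (b) the analysis lemmas R-T, D1 and the cited reduction (prose);
(c) nothing about `Ra ≠ 1000` or non-conduction backgrounds (`P > 0` rows need the extra coupling pieces `CE_p`, not emitted here).

FILE LAYOUT of the row-N0 evaluator (one namespace `Summit.NavierStokesRegularity.TurbBounds.Certs.N0.Evaluator` reopened across four files ≤ 400 lines, lead decision 55 (c)): `EvalData.lean` (§1–2: constants and the eight piece matrices — DATA) → `EvalRule.lean` (§3–4: the rule `Mel`, its pencil forms, Gram certificates of the pencil coefficients) → `EvalBlocks.lean` (§5: `eval_k`, each landed block `B0kk.A` IS the rule at its data) → `Evaluator.lean` (§6–8: the real pencil, the interval theorems, `cutoff`, **`certificate`** — the full statement of what is and is NOT kernel-checked is in THAT file's header); generic interval lemmas in `TurbBounds/IntervalLemma.lean` + `IntervalLemmaR.lean`.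
-/

set_option linter.style.longLine false
set_option linter.style.setOption false
set_option linter.unusedSimpArgs false
set_option maxRecDepth 100000

namespace Summit.NavierStokesRegularity.TurbBounds.Certs.N0.Evaluator

open Literature.Computation.Certificates Matrix

/-! ## 6. The real pencil (real wavenumber data AND real Young weight) and the transfer of block PSD facts to it -/

/-- The `ε`-dependent, data-free part over `ℝ`: `Mb − (Tε)·TW − (T/ε)·TT` for a REAL Young weight `ε` (lemma R-I′ produces
Young weights that are convex combinations of the blocks' rational ones). -/
noncomputable def MbR (ε : ℝ) : Matrix (Fin 18) (Fin 18) ℝ :=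
  Mb.map (Rat.cast : ℚ → ℝ) + (-((T : ℝ) * ε)) • TW.map (Rat.cast : ℚ → ℝ) + (-((T : ℝ) / ε)) • TT.map (Rat.cast : ℚ → ℝ)

/-- The mode rule over `ℝ` with REAL wavenumber data `(u, v)` (needed at `(1/K, K)` for irrational `K`) and real Young weight `ε`. -/
noncomputable def MelR (ε u v : ℝ) : Matrix (Fin 18) (Fin 18) ℝ :=
  MbR ε + u • Acoef.map (Rat.cast : ℚ → ℝ) + v • Bcoef.map (Rat.cast : ℚ → ℝ)

/-- Five-term form of the real rule. -/
theorem MelR_eq5 (ε u v : ℝ) : MelR ε u v = Mb.map (Rat.cast : ℚ → ℝ) + u • Acoef.map (Rat.cast : ℚ → ℝ) + v • Bcoef.map (Rat.cast : ℚ → ℝ)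
    + (-((T : ℝ) * ε)) • TW.map (Rat.cast : ℚ → ℝ) + (-((T : ℝ) / ε)) • TT.map (Rat.cast : ℚ → ℝ) := by
  ext i j
  simp only [MelR, MbR, Matrix.add_apply, Matrix.smul_apply, smul_eq_mul]
  ring

/-- At rational data and rational Young weight the real rule is the cast of the rational rule. -/
theorem MelR_eq_map (ε u v : ℚ) : MelR (ε : ℝ) (u : ℝ) (v : ℝ) = (Mel ε u v).map (Rat.cast : ℚ → ℝ) := by
  ext i j
  simp only [MelR, MbR, Mel_pencil5, Matrix.add_apply, Matrix.smul_apply, Matrix.map_apply, smul_eq_mul, Rat.cast_add,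
    Rat.cast_mul, Rat.cast_neg, Rat.cast_div]
  ring

/-- Transfer: if a kernel-certified PSD block `A` equals `den • Mel ε u v` with `den > 0`, the real rule is PSD at `(ε, u, v)`. -/
theorem MelR_posSemidef_of_eval {A : QMat} {den ε u v : ℚ} (hden : 0 < den) (h : A = den • Mel ε u v)
    (hA : (A.map (Rat.cast : ℚ → ℝ)).PosSemidef) {ε' u' v' : ℝ} (he : ε' = (ε : ℝ)) (hu : u' = (u : ℝ)) (hv : v' = (v : ℝ)) :
    (MelR ε' u' v').PosSemidef := by
  subst he; subst hu; subst hv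
  have hcast : A.map (Rat.cast : ℚ → ℝ) = (den : ℝ) • MelR (ε : ℝ) (u : ℝ) (v : ℝ) := by
    rw [MelR_eq_map, h]
    ext i j
    simp only [Matrix.map_apply, Matrix.smul_apply, smul_eq_mul, Rat.cast_mul]
  have hden' : (0 : ℝ) < (den : ℝ) := by exact_mod_cast hden
  have hinv : MelR (ε : ℝ) (u : ℝ) (v : ℝ) = (den : ℝ)⁻¹ • A.map (Rat.cast : ℚ → ℝ) := by
    rw [hcast, smul_smul, inv_mul_cancel₀ hden'.ne', one_smul]
  rw [hinv]
  exact hA.smul (inv_nonneg.mpr hden'.le)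

/-! ## 7. The 9 cover intervals (tree lemmas from `TurbBounds/IntervalLemma.lean` + `IntervalLemmaR.lean`: 'bottom' companion of R-I and lemma R-I′ = tangent pair with UNEQUAL Young weights) -/

/-- **Interval 1** `(0, 1/2]` (bottom block 1, `ε = ε1`): for every real `0 < K ≤ 1/2` the rule is PSD at `(1/K, K)` with both tail scalars `≥ 0`. -/
theorem interval_1 : ∀ K : ℝ, 0 < K → K ≤ ((1 : ℝ) / 2) → ∃ ε : ℝ, 0 < ε ∧ (MelR ε (1 / K) K).PosSemidef ∧
      0 ≤ 16 * (1 / K) * (a0 : ℝ) - (T : ℝ) * ε * (lamW : ℝ) ∧ 0 ≤ 4 * (s : ℝ) - (T : ℝ) * (lamT : ℝ) / ε := by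
  have h := MelR_posSemidef_of_eval den1_pos eval1 B001.posSemidef (ε' := (ε1 : ℝ)) (u' := 1 / ((1 : ℝ) / 2)) (v' := 0)
    rfl (by norm_num [u1]) (by norm_num [v1])
  intro K hK hK'
  refine ⟨(ε1 : ℝ), by norm_num [ε1], ?_, ?_, by norm_num [a0, s, Ra, T, ε1, lamT]⟩
  · exact posSemidef_pencil_on_bottom (MbR (ε1 : ℝ)) (Acoef.map (Rat.cast : ℚ → ℝ)) (Bcoef.map (Rat.cast : ℚ → ℝ))
      Acoef_posSemidef Bcoef_posSemidef h K hK hK'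
  · have h1 : 1 / (((1 : ℝ) / 2) : ℝ) ≤ 1 / K := one_div_le_one_div_of_le hK hK'
    have ha : (0 : ℝ) ≤ (a0 : ℝ) := by norm_num [a0, s, Ra]
    have hbase : (0 : ℝ) ≤ 16 * (1 / (((1 : ℝ) / 2) : ℝ)) * (a0 : ℝ) - (T : ℝ) * (ε1 : ℝ) * (lamW : ℝ) := by norm_num [a0, s, Ra, T, ε1, lamW]
    nlinarith [mul_le_mul_of_nonneg_right h1 ha]

/-- **Interval 2** `[1/2, 1]` (tangent pair: blocks 2 (`ε2`), 3 (`ε3`); `Kt = 1`; lemma R-I′): for every real `K` in it there is a Young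
weight `ε > 0` at which the rule is PSD at `(1/K, K)` with both tail scalars `≥ 0`. -/
theorem interval_2 : ∀ K : ℝ, ((1 : ℝ) / 2) ≤ K → K ≤ (1 : ℝ) → ∃ ε : ℝ, 0 < ε ∧ (MelR ε (1 / K) K).PosSemidef ∧
      0 ≤ 16 * (1 / K) * (a0 : ℝ) - (T : ℝ) * ε * (lamW : ℝ) ∧ 0 ≤ 4 * (s : ℝ) - (T : ℝ) * (lamT : ℝ) / ε := by
  have h1 := MelR_posSemidef_of_eval den2_pos eval2 B002.posSemidef (ε' := (ε2 : ℝ))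
    (u' := (2 * (1 : ℝ) - ((1 : ℝ) / 2)) / (1 : ℝ) ^ 2) (v' := ((1 : ℝ) / 2)) rfl (by norm_num [u2]) (by norm_num [v2])
  have h2 := MelR_posSemidef_of_eval den3_pos eval3 B003.posSemidef (ε' := (ε3 : ℝ))
    (u' := 1 / (1 : ℝ)) (v' := (1 : ℝ)) rfl (by norm_num [u3]) (by norm_num [v3])
  rw [MelR_eq5] at h1 h2
  intro K hK hK'
  obtain ⟨ε, hε, hP, hW, hT⟩ := pencil_on_interval_tangent_mixed (Mb.map (Rat.cast : ℚ → ℝ)) (Acoef.map (Rat.cast : ℚ → ℝ))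
    (Bcoef.map (Rat.cast : ℚ → ℝ)) (TW.map (Rat.cast : ℚ → ℝ)) (TT.map (Rat.cast : ℚ → ℝ)) Acoef_posSemidef TT_posSemidef
    (T := (T : ℝ)) (a := (a0 : ℝ)) (s := (s : ℝ)) (lW := (lamW : ℝ)) (lT := (lamT : ℝ))
    (by norm_num [T]) (by norm_num [a0, s, Ra]) (by norm_num [T, lamT])
    (by norm_num : (0 : ℝ) < ((1 : ℝ) / 2)) (by norm_num : (((1 : ℝ) / 2) : ℝ) ≤ (1 : ℝ)) (by norm_num [ε2] : (0 : ℝ) < (ε2 : ℝ)) (by norm_num [ε3] : (0 : ℝ) < (ε3 : ℝ))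
    h1 h2 (by norm_num [a0, s, Ra, T, ε2, lamW]) (by norm_num [a0, s, Ra, T, ε3, lamW]) (by norm_num [a0, s, Ra, T, ε2, lamT]) (by norm_num [a0, s, Ra, T, ε3, lamT])
    K hK hK'
  exact ⟨ε, hε, by rw [MelR_eq5]; exact hP, hW, hT⟩

/-- **Interval 3** `[1, 2]` (tangent pair: blocks 4 (`ε4`), 5 (`ε5`); `Kt = 2`; lemma R-I′): for every real `K` in it there is a Young
weight `ε > 0` at which the rule is PSD at `(1/K, K)` with both tail scalars `≥ 0`. -/
theorem interval_3 : ∀ K : ℝ, (1 : ℝ) ≤ K → K ≤ (2 : ℝ) → ∃ ε : ℝ, 0 < ε ∧ (MelR ε (1 / K) K).PosSemidef ∧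
      0 ≤ 16 * (1 / K) * (a0 : ℝ) - (T : ℝ) * ε * (lamW : ℝ) ∧ 0 ≤ 4 * (s : ℝ) - (T : ℝ) * (lamT : ℝ) / ε := by
  have h1 := MelR_posSemidef_of_eval den4_pos eval4 B004.posSemidef (ε' := (ε4 : ℝ))
    (u' := (2 * (2 : ℝ) - (1 : ℝ)) / (2 : ℝ) ^ 2) (v' := (1 : ℝ)) rfl (by norm_num [u4]) (by norm_num [v4])
  have h2 := MelR_posSemidef_of_eval den5_pos eval5 B005.posSemidef (ε' := (ε5 : ℝ))
    (u' := 1 / (2 : ℝ)) (v' := (2 : ℝ)) rfl (by norm_num [u5]) (by norm_num [v5])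
  rw [MelR_eq5] at h1 h2
  intro K hK hK'
  obtain ⟨ε, hε, hP, hW, hT⟩ := pencil_on_interval_tangent_mixed (Mb.map (Rat.cast : ℚ → ℝ)) (Acoef.map (Rat.cast : ℚ → ℝ))
    (Bcoef.map (Rat.cast : ℚ → ℝ)) (TW.map (Rat.cast : ℚ → ℝ)) (TT.map (Rat.cast : ℚ → ℝ)) Acoef_posSemidef TT_posSemidef
    (T := (T : ℝ)) (a := (a0 : ℝ)) (s := (s : ℝ)) (lW := (lamW : ℝ)) (lT := (lamT : ℝ))
    (by norm_num [T]) (by norm_num [a0, s, Ra]) (by norm_num [T, lamT])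
    (by norm_num : (0 : ℝ) < (1 : ℝ)) (by norm_num : ((1 : ℝ) : ℝ) ≤ (2 : ℝ)) (by norm_num [ε4] : (0 : ℝ) < (ε4 : ℝ)) (by norm_num [ε5] : (0 : ℝ) < (ε5 : ℝ))
    h1 h2 (by norm_num [a0, s, Ra, T, ε4, lamW]) (by norm_num [a0, s, Ra, T, ε5, lamW]) (by norm_num [a0, s, Ra, T, ε4, lamT]) (by norm_num [a0, s, Ra, T, ε5, lamT])
    K hK hK'
  exact ⟨ε, hε, by rw [MelR_eq5]; exact hP, hW, hT⟩

/-- **Interval 4** `[2, 4]` (tangent pair: blocks 6 (`ε6`), 7 (`ε7`); `Kt = 4`; lemma R-I′): for every real `K` in it there is a Young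
weight `ε > 0` at which the rule is PSD at `(1/K, K)` with both tail scalars `≥ 0`. -/
theorem interval_4 : ∀ K : ℝ, (2 : ℝ) ≤ K → K ≤ (4 : ℝ) → ∃ ε : ℝ, 0 < ε ∧ (MelR ε (1 / K) K).PosSemidef ∧
      0 ≤ 16 * (1 / K) * (a0 : ℝ) - (T : ℝ) * ε * (lamW : ℝ) ∧ 0 ≤ 4 * (s : ℝ) - (T : ℝ) * (lamT : ℝ) / ε := by
  have h1 := MelR_posSemidef_of_eval den6_pos eval6 B006.posSemidef (ε' := (ε6 : ℝ))
    (u' := (2 * (4 : ℝ) - (2 : ℝ)) / (4 : ℝ) ^ 2) (v' := (2 : ℝ)) rfl (by norm_num [u6]) (by norm_num [v6])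
  have h2 := MelR_posSemidef_of_eval den7_pos eval7 B007.posSemidef (ε' := (ε7 : ℝ))
    (u' := 1 / (4 : ℝ)) (v' := (4 : ℝ)) rfl (by norm_num [u7]) (by norm_num [v7])
  rw [MelR_eq5] at h1 h2
  intro K hK hK'
  obtain ⟨ε, hε, hP, hW, hT⟩ := pencil_on_interval_tangent_mixed (Mb.map (Rat.cast : ℚ → ℝ)) (Acoef.map (Rat.cast : ℚ → ℝ))
    (Bcoef.map (Rat.cast : ℚ → ℝ)) (TW.map (Rat.cast : ℚ → ℝ)) (TT.map (Rat.cast : ℚ → ℝ)) Acoef_posSemidef TT_posSemidef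
    (T := (T : ℝ)) (a := (a0 : ℝ)) (s := (s : ℝ)) (lW := (lamW : ℝ)) (lT := (lamT : ℝ))
    (by norm_num [T]) (by norm_num [a0, s, Ra]) (by norm_num [T, lamT])
    (by norm_num : (0 : ℝ) < (2 : ℝ)) (by norm_num : ((2 : ℝ) : ℝ) ≤ (4 : ℝ)) (by norm_num [ε6] : (0 : ℝ) < (ε6 : ℝ)) (by norm_num [ε7] : (0 : ℝ) < (ε7 : ℝ))
    h1 h2 (by norm_num [a0, s, Ra, T, ε6, lamW]) (by norm_num [a0, s, Ra, T, ε7, lamW]) (by norm_num [a0, s, Ra, T, ε6, lamT]) (by norm_num [a0, s, Ra, T, ε7, lamT])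
    K hK hK'
  exact ⟨ε, hε, by rw [MelR_eq5]; exact hP, hW, hT⟩

/-- **Interval 5** `[4, 8]` (tangent pair: blocks 8 (`ε8`), 9 (`ε9`); `Kt = 8`; lemma R-I′): for every real `K` in it there is a Young
weight `ε > 0` at which the rule is PSD at `(1/K, K)` with both tail scalars `≥ 0`. -/
theorem interval_5 : ∀ K : ℝ, (4 : ℝ) ≤ K → K ≤ (8 : ℝ) → ∃ ε : ℝ, 0 < ε ∧ (MelR ε (1 / K) K).PosSemidef ∧
      0 ≤ 16 * (1 / K) * (a0 : ℝ) - (T : ℝ) * ε * (lamW : ℝ) ∧ 0 ≤ 4 * (s : ℝ) - (T : ℝ) * (lamT : ℝ) / ε := by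
  have h1 := MelR_posSemidef_of_eval den8_pos eval8 B008.posSemidef (ε' := (ε8 : ℝ))
    (u' := (2 * (8 : ℝ) - (4 : ℝ)) / (8 : ℝ) ^ 2) (v' := (4 : ℝ)) rfl (by norm_num [u8]) (by norm_num [v8])
  have h2 := MelR_posSemidef_of_eval den9_pos eval9 B009.posSemidef (ε' := (ε9 : ℝ))
    (u' := 1 / (8 : ℝ)) (v' := (8 : ℝ)) rfl (by norm_num [u9]) (by norm_num [v9])
  rw [MelR_eq5] at h1 h2
  intro K hK hK'
  obtain ⟨ε, hε, hP, hW, hT⟩ := pencil_on_interval_tangent_mixed (Mb.map (Rat.cast : ℚ → ℝ)) (Acoef.map (Rat.cast : ℚ → ℝ))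
    (Bcoef.map (Rat.cast : ℚ → ℝ)) (TW.map (Rat.cast : ℚ → ℝ)) (TT.map (Rat.cast : ℚ → ℝ)) Acoef_posSemidef TT_posSemidef
    (T := (T : ℝ)) (a := (a0 : ℝ)) (s := (s : ℝ)) (lW := (lamW : ℝ)) (lT := (lamT : ℝ))
    (by norm_num [T]) (by norm_num [a0, s, Ra]) (by norm_num [T, lamT])
    (by norm_num : (0 : ℝ) < (4 : ℝ)) (by norm_num : ((4 : ℝ) : ℝ) ≤ (8 : ℝ)) (by norm_num [ε8] : (0 : ℝ) < (ε8 : ℝ)) (by norm_num [ε9] : (0 : ℝ) < (ε9 : ℝ))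
    h1 h2 (by norm_num [a0, s, Ra, T, ε8, lamW]) (by norm_num [a0, s, Ra, T, ε9, lamW]) (by norm_num [a0, s, Ra, T, ε8, lamT]) (by norm_num [a0, s, Ra, T, ε9, lamT])
    K hK hK'
  exact ⟨ε, hε, by rw [MelR_eq5]; exact hP, hW, hT⟩

/-- **Interval 6** `[8, 11585/1024]` (tangent pair: blocks 10 (`ε10`), 11 (`ε11`); `Kt = 11585/1024`; lemma R-I′): for every real `K` in it there is a Young
weight `ε > 0` at which the rule is PSD at `(1/K, K)` with both tail scalars `≥ 0`. -/
theorem interval_6 : ∀ K : ℝ, (8 : ℝ) ≤ K → K ≤ ((11585 : ℝ) / 1024) → ∃ ε : ℝ, 0 < ε ∧ (MelR ε (1 / K) K).PosSemidef ∧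
      0 ≤ 16 * (1 / K) * (a0 : ℝ) - (T : ℝ) * ε * (lamW : ℝ) ∧ 0 ≤ 4 * (s : ℝ) - (T : ℝ) * (lamT : ℝ) / ε := by
  have h1 := MelR_posSemidef_of_eval den10_pos eval10 B010.posSemidef (ε' := (ε10 : ℝ))
    (u' := (2 * ((11585 : ℝ) / 1024) - (8 : ℝ)) / ((11585 : ℝ) / 1024) ^ 2) (v' := (8 : ℝ)) rfl (by norm_num [u10]) (by norm_num [v10])
  have h2 := MelR_posSemidef_of_eval den11_pos eval11 B011.posSemidef (ε' := (ε11 : ℝ))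
    (u' := 1 / ((11585 : ℝ) / 1024)) (v' := ((11585 : ℝ) / 1024)) rfl (by norm_num [u11]) (by norm_num [v11])
  rw [MelR_eq5] at h1 h2
  intro K hK hK'
  obtain ⟨ε, hε, hP, hW, hT⟩ := pencil_on_interval_tangent_mixed (Mb.map (Rat.cast : ℚ → ℝ)) (Acoef.map (Rat.cast : ℚ → ℝ))
    (Bcoef.map (Rat.cast : ℚ → ℝ)) (TW.map (Rat.cast : ℚ → ℝ)) (TT.map (Rat.cast : ℚ → ℝ)) Acoef_posSemidef TT_posSemidef
    (T := (T : ℝ)) (a := (a0 : ℝ)) (s := (s : ℝ)) (lW := (lamW : ℝ)) (lT := (lamT : ℝ))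
    (by norm_num [T]) (by norm_num [a0, s, Ra]) (by norm_num [T, lamT])
    (by norm_num : (0 : ℝ) < (8 : ℝ)) (by norm_num : ((8 : ℝ) : ℝ) ≤ ((11585 : ℝ) / 1024)) (by norm_num [ε10] : (0 : ℝ) < (ε10 : ℝ)) (by norm_num [ε11] : (0 : ℝ) < (ε11 : ℝ))
    h1 h2 (by norm_num [a0, s, Ra, T, ε10, lamW]) (by norm_num [a0, s, Ra, T, ε11, lamW]) (by norm_num [a0, s, Ra, T, ε10, lamT]) (by norm_num [a0, s, Ra, T, ε11, lamT])
    K hK hK'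
  exact ⟨ε, hε, by rw [MelR_eq5]; exact hP, hW, hT⟩

/-- **Interval 7** `[11585/1024, 16]` (tangent pair: blocks 12 (`ε12`), 13 (`ε13`); `Kt = 16`; lemma R-I′): for every real `K` in it there is a Young
weight `ε > 0` at which the rule is PSD at `(1/K, K)` with both tail scalars `≥ 0`. -/
theorem interval_7 : ∀ K : ℝ, ((11585 : ℝ) / 1024) ≤ K → K ≤ (16 : ℝ) → ∃ ε : ℝ, 0 < ε ∧ (MelR ε (1 / K) K).PosSemidef ∧
      0 ≤ 16 * (1 / K) * (a0 : ℝ) - (T : ℝ) * ε * (lamW : ℝ) ∧ 0 ≤ 4 * (s : ℝ) - (T : ℝ) * (lamT : ℝ) / ε := by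
  have h1 := MelR_posSemidef_of_eval den12_pos eval12 B012.posSemidef (ε' := (ε12 : ℝ))
    (u' := (2 * (16 : ℝ) - ((11585 : ℝ) / 1024)) / (16 : ℝ) ^ 2) (v' := ((11585 : ℝ) / 1024)) rfl (by norm_num [u12]) (by norm_num [v12])
  have h2 := MelR_posSemidef_of_eval den13_pos eval13 B013.posSemidef (ε' := (ε13 : ℝ))
    (u' := 1 / (16 : ℝ)) (v' := (16 : ℝ)) rfl (by norm_num [u13]) (by norm_num [v13])
  rw [MelR_eq5] at h1 h2
  intro K hK hK'
  obtain ⟨ε, hε, hP, hW, hT⟩ := pencil_on_interval_tangent_mixed (Mb.map (Rat.cast : ℚ → ℝ)) (Acoef.map (Rat.cast : ℚ → ℝ))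
    (Bcoef.map (Rat.cast : ℚ → ℝ)) (TW.map (Rat.cast : ℚ → ℝ)) (TT.map (Rat.cast : ℚ → ℝ)) Acoef_posSemidef TT_posSemidef
    (T := (T : ℝ)) (a := (a0 : ℝ)) (s := (s : ℝ)) (lW := (lamW : ℝ)) (lT := (lamT : ℝ))
    (by norm_num [T]) (by norm_num [a0, s, Ra]) (by norm_num [T, lamT])
    (by norm_num : (0 : ℝ) < ((11585 : ℝ) / 1024)) (by norm_num : (((11585 : ℝ) / 1024) : ℝ) ≤ (16 : ℝ)) (by norm_num [ε12] : (0 : ℝ) < (ε12 : ℝ)) (by norm_num [ε13] : (0 : ℝ) < (ε13 : ℝ))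
    h1 h2 (by norm_num [a0, s, Ra, T, ε12, lamW]) (by norm_num [a0, s, Ra, T, ε13, lamW]) (by norm_num [a0, s, Ra, T, ε12, lamT]) (by norm_num [a0, s, Ra, T, ε13, lamT])
    K hK hK'
  exact ⟨ε, hε, by rw [MelR_eq5]; exact hP, hW, hT⟩

/-- **Interval 8** `[16, 32]` (tangent pair: blocks 14 (`ε14`), 15 (`ε15`); `Kt = 32`; lemma R-I′): for every real `K` in it there is a Young
weight `ε > 0` at which the rule is PSD at `(1/K, K)` with both tail scalars `≥ 0`. -/
theorem interval_8 : ∀ K : ℝ, (16 : ℝ) ≤ K → K ≤ (32 : ℝ) → ∃ ε : ℝ, 0 < ε ∧ (MelR ε (1 / K) K).PosSemidef ∧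
      0 ≤ 16 * (1 / K) * (a0 : ℝ) - (T : ℝ) * ε * (lamW : ℝ) ∧ 0 ≤ 4 * (s : ℝ) - (T : ℝ) * (lamT : ℝ) / ε := by
  have h1 := MelR_posSemidef_of_eval den14_pos eval14 B014.posSemidef (ε' := (ε14 : ℝ))
    (u' := (2 * (32 : ℝ) - (16 : ℝ)) / (32 : ℝ) ^ 2) (v' := (16 : ℝ)) rfl (by norm_num [u14]) (by norm_num [v14])
  have h2 := MelR_posSemidef_of_eval den15_pos eval15 B015.posSemidef (ε' := (ε15 : ℝ))
    (u' := 1 / (32 : ℝ)) (v' := (32 : ℝ)) rfl (by norm_num [u15]) (by norm_num [v15])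
  rw [MelR_eq5] at h1 h2
  intro K hK hK'
  obtain ⟨ε, hε, hP, hW, hT⟩ := pencil_on_interval_tangent_mixed (Mb.map (Rat.cast : ℚ → ℝ)) (Acoef.map (Rat.cast : ℚ → ℝ))
    (Bcoef.map (Rat.cast : ℚ → ℝ)) (TW.map (Rat.cast : ℚ → ℝ)) (TT.map (Rat.cast : ℚ → ℝ)) Acoef_posSemidef TT_posSemidef
    (T := (T : ℝ)) (a := (a0 : ℝ)) (s := (s : ℝ)) (lW := (lamW : ℝ)) (lT := (lamT : ℝ))
    (by norm_num [T]) (by norm_num [a0, s, Ra]) (by norm_num [T, lamT])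
    (by norm_num : (0 : ℝ) < (16 : ℝ)) (by norm_num : ((16 : ℝ) : ℝ) ≤ (32 : ℝ)) (by norm_num [ε14] : (0 : ℝ) < (ε14 : ℝ)) (by norm_num [ε15] : (0 : ℝ) < (ε15 : ℝ))
    h1 h2 (by norm_num [a0, s, Ra, T, ε14, lamW]) (by norm_num [a0, s, Ra, T, ε15, lamW]) (by norm_num [a0, s, Ra, T, ε14, lamT]) (by norm_num [a0, s, Ra, T, ε15, lamT])
    K hK hK'
  exact ⟨ε, hε, by rw [MelR_eq5]; exact hP, hW, hT⟩

/-- **Interval 9** `[32, 39]` (tangent pair: blocks 16 (`ε16`), 17 (`ε17`); `Kt = 39`; lemma R-I′): for every real `K` in it there is a Young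
weight `ε > 0` at which the rule is PSD at `(1/K, K)` with both tail scalars `≥ 0`. -/
theorem interval_9 : ∀ K : ℝ, (32 : ℝ) ≤ K → K ≤ (39 : ℝ) → ∃ ε : ℝ, 0 < ε ∧ (MelR ε (1 / K) K).PosSemidef ∧
      0 ≤ 16 * (1 / K) * (a0 : ℝ) - (T : ℝ) * ε * (lamW : ℝ) ∧ 0 ≤ 4 * (s : ℝ) - (T : ℝ) * (lamT : ℝ) / ε := by
  have h1 := MelR_posSemidef_of_eval den16_pos eval16 B016.posSemidef (ε' := (ε16 : ℝ))
    (u' := (2 * (39 : ℝ) - (32 : ℝ)) / (39 : ℝ) ^ 2) (v' := (32 : ℝ)) rfl (by norm_num [u16]) (by norm_num [v16])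
  have h2 := MelR_posSemidef_of_eval den17_pos eval17 B017.posSemidef (ε' := (ε17 : ℝ))
    (u' := 1 / (39 : ℝ)) (v' := (39 : ℝ)) rfl (by norm_num [u17]) (by norm_num [v17])
  rw [MelR_eq5] at h1 h2
  intro K hK hK'
  obtain ⟨ε, hε, hP, hW, hT⟩ := pencil_on_interval_tangent_mixed (Mb.map (Rat.cast : ℚ → ℝ)) (Acoef.map (Rat.cast : ℚ → ℝ))
    (Bcoef.map (Rat.cast : ℚ → ℝ)) (TW.map (Rat.cast : ℚ → ℝ)) (TT.map (Rat.cast : ℚ → ℝ)) Acoef_posSemidef TT_posSemidef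
    (T := (T : ℝ)) (a := (a0 : ℝ)) (s := (s : ℝ)) (lW := (lamW : ℝ)) (lT := (lamT : ℝ))
    (by norm_num [T]) (by norm_num [a0, s, Ra]) (by norm_num [T, lamT])
    (by norm_num : (0 : ℝ) < (32 : ℝ)) (by norm_num : ((32 : ℝ) : ℝ) ≤ (39 : ℝ)) (by norm_num [ε16] : (0 : ℝ) < (ε16 : ℝ)) (by norm_num [ε17] : (0 : ℝ) < (ε17 : ℝ))
    h1 h2 (by norm_num [a0, s, Ra, T, ε16, lamW]) (by norm_num [a0, s, Ra, T, ε17, lamW]) (by norm_num [a0, s, Ra, T, ε16, lamT]) (by norm_num [a0, s, Ra, T, ε17, lamT])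
    K hK hK'
  exact ⟨ε, hε, by rw [MelR_eq5]; exact hP, hW, hT⟩

/-! ## 8. The cutoff scalar and the assembled certificate -/

/-- **Cutoff scalar** (rbsdp SPEC 3.8, lemma D1 with explicit `K`: every `k² ≥ K_c` is free): `T² ≤ ((s−1)/Ra)·s·K_c²`, i.e. `9 ≤ 4563/500`. -/
theorem cutoff : T ^ 2 ≤ a0 * s * K_c ^ 2 := by norm_num [T, a0, s, Ra, K_c]

/-- **THE FINITE CERTIFICATE OF ROW N0 ON THE CONTINUUM.** For every real wavenumber datum `0 < K = k² ≤ K_c = 39` the row's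
mode LMI holds AT `(u, v) = (1/K, K)` for SOME Young weight `ε > 0` together with both scalar tail conditions of rbsdp SPEC 3.7:
`MelR ε (1/K) K ⪰ 0`, `16(1/K)(s−1)/Ra − Tελ_W ≥ 0` and `4s − Tλ_T/ε ≥ 0`. Assembled from `interval_1 … interval_9`; see the module
docstring for what this implies (via refereed prose) and what it does not check. -/
theorem certificate (K : ℝ) (hK : 0 < K) (hKc : K ≤ (K_c : ℝ)) :
    ∃ ε : ℝ, 0 < ε ∧ (MelR ε (1 / K) K).PosSemidef ∧
      0 ≤ 16 * (1 / K) * (a0 : ℝ) - (T : ℝ) * ε * (lamW : ℝ) ∧ 0 ≤ 4 * (s : ℝ) - (T : ℝ) * (lamT : ℝ) / ε := by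
  have hKc' : K ≤ (39 : ℝ) := by
    have e : ((K_c : ℚ) : ℝ) = (39 : ℝ) := by norm_num [K_c]
    rw [e] at hKc
    exact hKc
  by_cases hc1 : K ≤ ((1 : ℝ) / 2)
  · exact interval_1 K hK hc1
  have hc1' : ((1 : ℝ) / 2) < K := not_le.mp hc1
  by_cases hc2 : K ≤ (1 : ℝ)
  · exact interval_2 K hc1'.le hc2
  have hc2' : (1 : ℝ) < K := not_le.mp hc2
  by_cases hc3 : K ≤ (2 : ℝ)
  · exact interval_3 K hc2'.le hc3
  have hc3' : (2 : ℝ) < K := not_le.mp hc3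
  by_cases hc4 : K ≤ (4 : ℝ)
  · exact interval_4 K hc3'.le hc4
  have hc4' : (4 : ℝ) < K := not_le.mp hc4
  by_cases hc5 : K ≤ (8 : ℝ)
  · exact interval_5 K hc4'.le hc5
  have hc5' : (8 : ℝ) < K := not_le.mp hc5
  by_cases hc6 : K ≤ ((11585 : ℝ) / 1024)
  · exact interval_6 K hc5'.le hc6
  have hc6' : ((11585 : ℝ) / 1024) < K := not_le.mp hc6
  by_cases hc7 : K ≤ (16 : ℝ)
  · exact interval_7 K hc6'.le hc7
  have hc7' : (16 : ℝ) < K := not_le.mp hc7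
  by_cases hc8 : K ≤ (32 : ℝ)
  · exact interval_8 K hc7'.le hc8
  have hc8' : (32 : ℝ) < K := not_le.mp hc8
  exact interval_9 K hc8'.le hKc'

end Summit.NavierStokesRegularity.TurbBounds.Certs.N0.Evaluator
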